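import Mathlib.Data.ZMod.Basic
import Mathlib.LinearAlgebra.FreeModule.IdealQuotient
import Mathlib.NumberTheory.RamificationInertia.Valuation
import Mathlib.RingTheory.RamificationInertia.Ramification
import Literature.NumberTheory.GaloisRepresentations.SplitsCompletelyCriteria
import Literature.NumberTheory.Automorphic.AdicCompletionCompact
import Literature.NumberTheory.Automorphic.AdicCompletionUnitNorms
import Literature.RingTheory.DiscreteValuationRing.AdicCompletionHensel
import HarnessLib

/-!
# Square criteria for integers in the completions `K_v` of a number field

Topic `NumberTheory/NumberFields`; namespace `Literature.NumberTheory.NumberFields`. Theorems only (no definition, no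
named fact), all fully proved. For a number field `K`, a finite place `v` (a height-one prime of
`𝓞 K`) with completion `K_v = v.adicCompletion K`, and an integer `d ∈ ℤ`, the elementary local
criteria deciding whether `d ∈ K_v²` that are used when an auxiliary quadratic field `ℚ(√d)` is
chosen by the Chinese remainder theorem with prescribed behaviour at finitely many places of `K`
(non-split at some, split at others):

* `not_isSquare_adicCompletion_of_odd_log_valuation` — **`ord_v x` odd ⟹ `x ∉ K_v²`**
  (`ord_v(c²) = 2 ord_v(c)`);
* `not_isSquare_adicCompletion_intCast_of_dvd_of_not_sq_dvd` — **`v ∣ ℓ` absolutely unramified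
  (`e(v|ℓ) = 1`, Mathlib's `Ideal.ramificationIdx v ℤ = 1`) and `ℓ ∥ d` ⟹ `d ∉ K_v²`**
  (`ord_v d = e · ord_ℓ d = 1`, Mathlib `intValuation_liesOver`);
* `not_isSquare_adicCompletion_intCast_of_not_isSquare_zmod` — **`N v = ℓ`, `ℓ ∤ d`, `d` a
  non-residue mod `ℓ` ⟹ `d ∉ K_v²`** (a `v`-unit square of `K_v` is congruent to the square of a
  global integer modulo `v` — density of `𝓞 K` in `𝒪_v` — and `𝓞 K ⧸ v ≅ ℤ/ℓ`);
* `not_isSquare_adicCompletion_intCast_of_emod_eight_eq_five` — **`N v = 2`, `d ≡ 5 (mod 8)` ⟹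
  `d ∉ K_v²`**, for ANY ramification of `v` over `2`: if `x² = d` then `y = (1 + x)/2` has
  `y² - y = (d - 1)/4`, a `v`-unit, forcing `y ∈ 𝒪_v`; but `a² ≡ a (mod v)` for every `a ∈ 𝓞 K`
  (the residue field is `𝔽₂`) and `y ≡ a (mod 𝔪_v)` for some such `a`, so `y² - y ∈ 𝔪_v` —
  contradiction (equivalently: `ℚ₂(√5)/ℚ₂` is unramified, so `√5 ∈ K_v` forces `𝔽₄ ⊆ κ(v)`);
* `isSquare_adicCompletion_intCast_of_dvd_sub_one` — **`v ∣ ℓ`, `ℓ` odd, `ℓ ∣ d - 1` ⟹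
  `d ∈ K_v²`** (Hensel's lemma for `X² - d` at `1` in the Henselian ring `𝒪_v`,
  `Literature.NumberTheory.Automorphic.exists_sq_eq_of_sq_sub_mem_maximalIdeal` with the instance
  `adicCompletionIntegers.henselianLocalRing` of
  `Literature/RingTheory/DiscreteValuationRing/AdicCompletionHensel.lean`);
* `isSquare_adicCompletion_intCast_of_eight_dvd_sub_one` — **`v ∣ 2`, `8 ∣ d - 1` ⟹ `d ∈ K_v²`**
  for ANY ramification of `v` over `2` (Hensel for `X² + X - 2k`, `d = 1 + 8k`, at the simple root `0`;
  then `(2y + 1)² = d`);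

with the two bookkeeping lemmas `intCast_mem_asIdeal_iff_of_natCast_mem` (`v ∩ ℤ = pℤ` for
`p ∈ v`) and `valued_intCast_adicCompletion` (`|n|_v = ord_v`-valuation of `n ∈ 𝓞 K`), and
`sq_sub_self_mem_of_absNorm_eq_two` (`a² ≡ a` modulo an ideal of norm `2`).

These are the standard facts of O'Meara §63 (local squares: 63:1 Local Square Theorem, 63:2–63:5 at
non-dyadic and dyadic spots) and Serre, *A Course in Arithmetic*, Ch. II §3.3 (squares in `ℚ_pˣ`),
in the generality of an arbitrary completion `K_v` but only for the residue-degree-one /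
unit / uniformiser cases needed by CRT constructions. Not here: the full structure of
`K_vˣ/K_vˣ²` (see `QuadraticForms/SquareClassIndex.lean`), the full dyadic unit square theorem
`1 + 4𝔭_v ⊆ K_v²` for ramified `v ∣ 2` (O'Meara 63:3–63:5) beyond its `1 + 8𝒪_v` part.

## References

* O. T. O'Meara, *Introduction to Quadratic Forms*, Grundlehren 117, Springer (1963), §63A
  (63:1, 63:1a: local squares via Hensel; 63:2: units of non-square residue). [Omeara1963]
* J.-P. Serre, *A Course in Arithmetic*, GTM 7, Springer (1973), Ch. II §3.3. [Serre1973]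
* J. W. S. Cassels, *Local Fields*, LMS Student Texts 3 (1986), Ch. 4 Lemma 3.1 (Hensel).
  [Cassels1986]
-/

noncomputable section

open scoped NumberField Valued
open NumberField IsDedekindDomain

namespace Literature.NumberTheory.NumberFields

open Literature.NumberTheory.GaloisRepresentations Literature.NumberTheory.Automorphic

variable {K : Type*} [Field K] [NumberField K]

/-! ### Integers at a place above a rational prime -/

omit [NumberField K] in
/-- If the prime `v` of `𝓞 K` contains the rational prime `p`, then an integer `n` lies in `v` iff
`p ∣ n` (`v ∩ ℤ = pℤ`, `liesOver_span_of_natCast_mem_asIdeal`). [folklore] -/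
theorem intCast_mem_asIdeal_iff_of_natCast_mem {p : ℕ} (hp : p.Prime) (v : HeightOneSpectrum (𝓞 K))
    (hv : ((p : ℕ) : 𝓞 K) ∈ v.asIdeal) (n : ℤ) :
    (n : 𝓞 K) ∈ v.asIdeal ↔ (p : ℤ) ∣ n := by
  have h := (liesOver_span_of_natCast_mem_asIdeal hp v hv).over
  rw [← Ideal.mem_span_singleton, h, Ideal.under_def, Ideal.mem_comap, eq_intCast]

/-- The valuation in `K_v` of (the image of) an integer `n` is the `v`-adic valuation of `n ∈ 𝓞 K`.
[folklore] -/
theorem valued_intCast_adicCompletion (v : HeightOneSpectrum (𝓞 K)) (n : ℤ) :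
    Valued.v ((n : v.adicCompletion K)) = v.intValuation (n : 𝓞 K) := by
  rw [← map_intCast (algebraMap K (v.adicCompletion K)) n,
    ← map_intCast (algebraMap (𝓞 K) K) n]
  exact (HeightOneSpectrum.valuedAdicCompletion_eq_valuation' v _).trans
    (HeightOneSpectrum.valuation_of_algebraMap v _)

/-- At a place `v ∋ p`, an integer prime to `p` is a `v`-adic unit: `|n|_v = 1`. [folklore] -/
theorem valued_intCast_adicCompletion_eq_one {p : ℕ} (hp : p.Prime) (v : HeightOneSpectrum (𝓞 K))
    (hv : ((p : ℕ) : 𝓞 K) ∈ v.asIdeal) {n : ℤ} (hn : ¬ (p : ℤ) ∣ n) :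
    Valued.v ((n : v.adicCompletion K)) = 1 := by
  rw [valued_intCast_adicCompletion]
  exact HeightOneSpectrum.intValuation_eq_one_iff.2
    (fun h => hn ((intCast_mem_asIdeal_iff_of_natCast_mem hp v hv n).1 h))

/-! ### Odd valuation -/

/-- **An element of odd valuation is not a square in `K_v`** (`ord_v(c²) = 2 ord_v(c)`; O'Meara
§63A). [folklore] -/
theorem not_isSquare_adicCompletion_of_odd_log_valuation (v : HeightOneSpectrum (𝓞 K)) {x : K}
    (hx : x ≠ 0) (hodd : ¬ (2 : ℤ) ∣ WithZero.log (v.valuation K x)) :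
    ¬ IsSquare (algebraMap K (v.adicCompletion K) x) := by
  rintro ⟨c, hc⟩
  have hval : ∀ r : K, Valued.v (algebraMap K (v.adicCompletion K) r) = v.valuation K r :=
    fun r => HeightOneSpectrum.valuedAdicCompletion_eq_valuation' v r
  have hc0 : c ≠ 0 := by
    rintro rfl
    rw [mul_zero, map_eq_zero_iff _ (algebraMap K (v.adicCompletion K)).injective] at hc
    exact hx hc
  have hvc : Valued.v c ≠ 0 := (Valuation.ne_zero_iff _).2 hc0
  apply hodd
  rw [← hval, hc, map_mul, WithZero.log_mul hvc hvc]
  exact ⟨WithZero.log (Valued.v c), (two_mul _).symm⟩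

/-! ### `ℓ ∥ d` at a place with `e(v | ℓ) = 1` -/

/-- **`ℓ ∥ d` is not a square in `K_v` at a place `v ∣ ℓ` with `e(v | ℓ) = 1`**: by Mathlib's
`intValuation_liesOver`, `ord_v d = e(v|ℓ) · ord_ℓ d = 1` is odd. (Here `e(v|ℓ)` is Mathlib's
`Ideal.ramificationIdx v ℤ`, equal to `ramificationIdx' (ℓ) v` by
`Ideal.ramificationIdx'_eq_ramificationIdx`.) [folklore] -/
theorem not_isSquare_adicCompletion_intCast_of_dvd_of_not_sq_dvd (v : HeightOneSpectrum (𝓞 K))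
    {ℓ : ℕ} (hℓ : ℓ.Prime) (hℓv : ((ℓ : ℕ) : 𝓞 K) ∈ v.asIdeal) (he : v.asIdeal.ramificationIdx ℤ = 1)
    {d : ℤ} (h1 : (ℓ : ℤ) ∣ d) (h2 : ¬ ((ℓ : ℤ) ^ 2 ∣ d)) :
    ¬ IsSquare (algebraMap K (v.adicCompletion K) (d : K)) := by
  have hℓ0 : (ℓ : ℤ) ≠ 0 := by exact_mod_cast hℓ.ne_zero
  have hd0 : d ≠ 0 := by
    rintro rfl
    exact h2 (dvd_zero _)
  -- the place `(ℓ)` of `ℤ` below `v`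
  have hprime : (Ideal.span {(ℓ : ℤ)}).IsPrime :=
    (Ideal.span_singleton_prime hℓ0).mpr (Nat.prime_iff_prime_int.mp hℓ)
  have hbot : Ideal.span {(ℓ : ℤ)} ≠ ⊥ := by
    rw [ne_eq, Ideal.span_singleton_eq_bot]
    exact hℓ0
  set u : HeightOneSpectrum ℤ := ⟨Ideal.span {(ℓ : ℤ)}, hprime, hbot⟩ with hu
  haveI hlo : v.asIdeal.LiesOver u.asIdeal := liesOver_span_of_natCast_mem_asIdeal hℓ v hℓv
  -- `e(v | ℓ) = 1`
  have he' : u.asIdeal.ramificationIdx' v.asIdeal = 1 := by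
    rw [Ideal.ramificationIdx'_eq_ramificationIdx u.asIdeal v.asIdeal hbot]
    exact he
  -- `ord_ℓ d = 1`
  obtain ⟨d', rfl⟩ := h1
  have hd' : ¬ (ℓ : ℤ) ∣ d' := fun h => h2 (by rw [sq]; exact mul_dvd_mul_left _ h)
  have hud : u.intValuation ((ℓ : ℤ) * d') = WithZero.exp (-1 : ℤ) := by
    rw [map_mul, HeightOneSpectrum.intValuation_singleton (v := u) hℓ0 rfl,
      HeightOneSpectrum.intValuation_eq_one_iff.2 (by rwa [hu, Ideal.mem_span_singleton]), mul_one]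
  -- transfer to `v`
  have hvd : v.intValuation (((ℓ : ℤ) * d' : ℤ) : 𝓞 K) = WithZero.exp (-1 : ℤ) := by
    have h := HeightOneSpectrum.intValuation_liesOver u v ((ℓ : ℤ) * d')
    rw [he', pow_one, hud] at h
    rw [← map_intCast (algebraMap ℤ (𝓞 K))]
    exact h.symm
  refine not_isSquare_adicCompletion_of_odd_log_valuation v (by exact_mod_cast hd0) ?_
  rw [← map_intCast (algebraMap (𝓞 K) K), HeightOneSpectrum.valuation_of_algebraMap, hvd,
    WithZero.log_exp]
  decide

/-! ### Unit non-residue at a place of degree one -/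

/-- **A unit integer which is a non-residue modulo `ℓ = N v` is not a square in `K_v`** (O'Meara
63:2 / Serre II §3.3 at a place of degree one, where `𝓞 K ⧸ v ≅ ℤ/ℓ`): if `c² = d` in `K_v` then
`c ∈ 𝒪_vˣ` is congruent modulo `𝔪_v` to a global integer `a` (`𝓞 K` is dense in `𝒪_v`,
`Literature.NumberTheory.Automorphic.exists_ringOfIntegers_valued_sub_lt_one`), and `a² ≡ d (mod v)`.
[cite: Omeara1963, §63A 63:2] -/
theorem not_isSquare_adicCompletion_intCast_of_not_isSquare_zmod (v : HeightOneSpectrum (𝓞 K))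
    {ℓ : ℕ} (hℓ : ℓ.Prime) (hN : Ideal.absNorm v.asIdeal = ℓ) {d : ℤ} (hℓd : ¬ ((ℓ : ℤ) ∣ d))
    (hsq : ¬ IsSquare ((d : ZMod ℓ))) :
    ¬ IsSquare (algebraMap K (v.adicCompletion K) (d : K)) := by
  classical
  rintro ⟨c, hc⟩
  have hval : ∀ r : K, Valued.v (algebraMap K (v.adicCompletion K) r) = v.valuation K r :=
    fun r => HeightOneSpectrum.valuedAdicCompletion_eq_valuation' v r
  have hℓv : ((ℓ : ℕ) : 𝓞 K) ∈ v.asIdeal := by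
    have h := Ideal.absNorm_mem v.asIdeal
    rwa [hN] at h
  -- `|d|_v = |c|_v = 1`
  have hcc : c * c = (d : v.adicCompletion K) := by rw [← hc, map_intCast]
  have hvd : Valued.v ((d : v.adicCompletion K)) = 1 :=
    valued_intCast_adicCompletion_eq_one hℓ v hℓv hℓd
  have hvc : Valued.v c = 1 := by
    have hcp : Valued.v c ^ 2 = 1 := by rw [← map_pow, sq, hcc, hvd]
    rcases lt_trichotomy (Valued.v c) 1 with h | h | h
    · exact absurd hcp (pow_lt_one₀ zero_le h two_ne_zero).ne
    · exact h
    · exact absurd hcp (one_lt_pow₀ h two_ne_zero).ne'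
  -- approximate `c` by a global integer `a`: then `a² ≡ d (mod v)`
  obtain ⟨a, ha⟩ := exists_ringOfIntegers_valued_sub_lt_one K v
    ⟨c, (Valuation.mem_valuationSubring_iff _ _).2 hvc.le⟩
  set A : v.adicCompletion K := algebraMap K (v.adicCompletion K) (algebraMap (𝓞 K) K a) with hA
  change Valued.v (A - c) < 1 at ha
  have hvA : Valued.v A ≤ 1 := by
    rw [hA, hval]
    exact HeightOneSpectrum.valuation_le_one v a
  have hmem : a ^ 2 - (d : 𝓞 K) ∈ v.asIdeal := by
    rw [← HeightOneSpectrum.valuation_lt_one_iff_mem (K := K), ← hval]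
    have h : algebraMap K (v.adicCompletion K) (algebraMap (𝓞 K) K (a ^ 2 - (d : 𝓞 K))) =
        (A - c) * (A + c) := by
      rw [map_sub, map_pow, map_sub, map_pow, map_intCast, map_intCast, ← hA, ← hcc]
      ring
    rw [h, map_mul]
    have hAc : Valued.v (A + c) ≤ 1 := le_trans (Valuation.map_add _ _ _) (max_le hvA hvc.le)
    calc Valued.v (A - c) * Valued.v (A + c) ≤ Valued.v (A - c) * 1 := mul_le_mul_right hAc _
      _ < 1 := by rw [mul_one]; exact ha
  -- `𝓞 K ⧸ v ≅ ℤ/ℓ`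
  haveI : Finite (𝓞 K ⧸ v.asIdeal) := Ideal.finiteQuotientOfFreeOfNeBot _ v.ne_bot
  letI : Fintype (𝓞 K ⧸ v.asIdeal) := Fintype.ofFinite _
  have hcard : Fintype.card (𝓞 K ⧸ v.asIdeal) = ℓ := by
    rw [← Nat.card_eq_fintype_card, ← Submodule.cardQuot_apply, ← Ideal.absNorm_apply, hN]
  let ψ := (ZMod.ringEquivOfPrime (𝓞 K ⧸ v.asIdeal) hℓ hcard).symm
  apply hsq
  refine ⟨ψ (Ideal.Quotient.mk v.asIdeal a), ?_⟩
  have hq : Ideal.Quotient.mk v.asIdeal (a ^ 2) = Ideal.Quotient.mk v.asIdeal (d : 𝓞 K) := by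
    rw [Ideal.Quotient.eq]
    exact hmem
  rw [← map_mul, ← sq, ← map_pow, hq, map_intCast, map_intCast]

/-! ### `d ≡ 5 (mod 8)` at a place of degree one above `2` -/

/-- In a ring with two elements `a² = a`; hence `a² - a ∈ I` for an ideal `I ⊆ 𝓞 K` of norm `2`.
[folklore] -/
theorem sq_sub_self_mem_of_absNorm_eq_two {I : Ideal (𝓞 K)} (h2 : Ideal.absNorm I = 2) (a : 𝓞 K) :
    a ^ 2 - a ∈ I := by
  classical
  have hI : I ≠ ⊥ := by
    rintro rfl
    rw [Ideal.absNorm_bot] at h2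
    exact absurd h2 (by norm_num)
  have hItop : I ≠ ⊤ := by
    rintro rfl
    rw [Ideal.absNorm_top] at h2
    exact absurd h2 (by norm_num)
  haveI : Finite (𝓞 K ⧸ I) := Ideal.finiteQuotientOfFreeOfNeBot I hI
  have h01 : (0 : 𝓞 K ⧸ I) ≠ 1 := Ideal.Quotient.zero_ne_one_iff.2 hItop
  have hcard : Nat.card (𝓞 K ⧸ I) = 2 := by
    rw [← Submodule.cardQuot_apply, ← Ideal.absNorm_apply, h2]
  rw [← Ideal.Quotient.eq_zero_iff_mem, map_sub, map_pow, sub_eq_zero]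
  obtain ⟨u, -, huniq⟩ := (Nat.card_eq_two_iff' (0 : 𝓞 K ⧸ I)).1 hcard
  rcases eq_or_ne (Ideal.Quotient.mk I a) 0 with hx | hx
  · rw [hx, sq, mul_zero]
  · have hx1 : Ideal.Quotient.mk I a = 1 := (huniq _ hx).trans (huniq 1 h01.symm).symm
    rw [hx1, one_pow]

/-- **`d ≡ 5 (mod 8)` is not a square in `K_v` when `N v = 2`** (residue field `𝔽₂`, any
ramification index over `2`): if `x² = d` in `K_v` then `y = (1 + x)/2` satisfies
`y² - y = (d - 1)/4`, a `v`-adic unit, which forces `y ∈ 𝒪_v`; but `y ≡ a (mod 𝔪_v)` for some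
`a ∈ 𝓞 K` and `a² ≡ a (mod v)`, so `y² - y ∈ 𝔪_v` — a contradiction. (For `K = ℚ`: `5 ∉ ℚ₂²`,
Serre II §3.3; in general `ℚ₂(√5)/ℚ₂` is unramified, so `√5 ∈ K_v` would force `𝔽₄ ⊆ κ(v)`.)
[folklore] -/
theorem not_isSquare_adicCompletion_intCast_of_emod_eight_eq_five (v : HeightOneSpectrum (𝓞 K))
    (h2 : Ideal.absNorm v.asIdeal = 2) {d : ℤ} (hd : d % 8 = 5) :
    ¬ IsSquare (algebraMap K (v.adicCompletion K) (d : K)) := by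
  classical
  rintro ⟨c, hc⟩
  haveI : CharZero (v.adicCompletion K) :=
    charZero_of_injective_algebraMap (algebraMap K (v.adicCompletion K)).injective
  have hval : ∀ r : K, Valued.v (algebraMap K (v.adicCompletion K) r) = v.valuation K r :=
    fun r => HeightOneSpectrum.valuedAdicCompletion_eq_valuation' v r
  have h2v : ((2 : ℕ) : 𝓞 K) ∈ v.asIdeal := by
    have h := Ideal.absNorm_mem v.asIdeal
    rwa [h2] at h
  -- the odd integer `m = (d - 1)/4`
  set m : ℤ := 2 * (d / 8) + 1 with hm
  have hdm : d - 1 = 4 * m := by omega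
  have hvm : Valued.v ((m : v.adicCompletion K)) = 1 :=
    valued_intCast_adicCompletion_eq_one Nat.prime_two v h2v (by omega)
  -- `y = (1 + c)/2` with `y² - y = m`
  set y : v.adicCompletion K := (1 + c) / 2 with hy
  have hcc : c * c = (d : v.adicCompletion K) := by rw [← hc, map_intCast]
  have hyy : y ^ 2 - y = (m : v.adicCompletion K) := by
    have h4 : (4 : v.adicCompletion K) ≠ 0 := by norm_num
    have hmK : (4 : v.adicCompletion K) * (m : v.adicCompletion K) = (d : v.adicCompletion K) - 1 := by
      have h := congrArg (Int.cast : ℤ → v.adicCompletion K) hdm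
      push_cast at h
      exact h.symm
    apply mul_left_cancel₀ h4
    rw [hmK, hy, ← hcc]
    ring
  -- `y ∈ 𝒪_v`
  have hvy : Valued.v y ≤ 1 := by
    by_contra hgt
    rw [not_le] at hgt
    have hy1 : Valued.v (y - 1) = Valued.v y :=
      Valuation.map_sub_eq_of_lt_left _ (by rw [Valuation.map_one]; exact hgt)
    have h : Valued.v (y ^ 2 - y) = Valued.v y * Valued.v y := by
      rw [show y ^ 2 - y = y * (y - 1) by ring, map_mul, hy1]
    rw [hyy, hvm] at h
    have h1 : (1 : WithZero (Multiplicative ℤ)) < Valued.v y * Valued.v y := one_lt_mul'' hgt hgt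
    rw [← h] at h1
    exact lt_irrefl _ h1
  -- approximate `y` by `a ∈ 𝓞 K`
  obtain ⟨a, ha⟩ := exists_ringOfIntegers_valued_sub_lt_one K v
    ⟨y, (Valuation.mem_valuationSubring_iff _ _).2 hvy⟩
  set A : v.adicCompletion K := algebraMap K (v.adicCompletion K) (algebraMap (𝓞 K) K a) with hA
  change Valued.v (A - y) < 1 at ha
  have hvA : Valued.v A ≤ 1 := by
    rw [hA, hval]
    exact HeightOneSpectrum.valuation_le_one v a
  have hvAA : Valued.v (A ^ 2 - A) < 1 := by
    have h : A ^ 2 - A = algebraMap K (v.adicCompletion K) (algebraMap (𝓞 K) K (a ^ 2 - a)) := by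
      rw [map_sub, map_pow, map_sub, map_pow]
    rw [h, hval, HeightOneSpectrum.valuation_lt_one_iff_mem]
    exact sq_sub_self_mem_of_absNorm_eq_two h2 a
  have key : y ^ 2 - y = (A ^ 2 - A) + (y - A) * (y + A - 1) := by ring
  have hprod : Valued.v ((y - A) * (y + A - 1)) < 1 := by
    rw [map_mul]
    have hyA : Valued.v (y - A) < 1 := by rw [Valuation.map_sub_swap]; exact ha
    have hsum : Valued.v (y + A - 1) ≤ 1 := by
      refine le_trans (Valuation.map_sub _ _ _) (max_le ?_ (by rw [Valuation.map_one]))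
      exact le_trans (Valuation.map_add _ _ _) (max_le hvy hvA)
    calc Valued.v (y - A) * Valued.v (y + A - 1) ≤ Valued.v (y - A) * 1 :=
          mul_le_mul_right hsum _
      _ < 1 := by rw [mul_one]; exact hyA
  have hlt : Valued.v (y ^ 2 - y) < 1 := by
    rw [key]
    exact lt_of_le_of_lt (Valuation.map_add _ _ _) (max_lt hvAA hprod)
  rw [hyy, hvm] at hlt
  exact lt_irrefl _ hlt

/-! ### Hensel: `d ≡ 1 (mod ℓ)`, `ℓ` odd -/

/-- **`d ≡ 1 (mod ℓ)` is a square in `K_v` for `v ∣ ℓ`, `ℓ` odd** (Hensel's lemma for `X² - d` at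
`1` in the Henselian ring `𝒪_v`, where `2 ∈ 𝒪_vˣ`; O'Meara 63:1a, Cassels, *Local Fields*, Ch. 4
Lemma 3.1). [cite: Cassels1986, Ch. 4 Lemma 3.1] -/
theorem isSquare_adicCompletion_intCast_of_dvd_sub_one (v : HeightOneSpectrum (𝓞 K)) {ℓ : ℕ}
    (hℓ : ℓ.Prime) (hℓ2 : ℓ ≠ 2) (hℓv : ((ℓ : ℕ) : 𝓞 K) ∈ v.asIdeal) {d : ℤ}
    (hd : (ℓ : ℤ) ∣ d - 1) :
    IsSquare (algebraMap K (v.adicCompletion K) (d : K)) := by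
  haveI : HenselianLocalRing 𝒪[v.adicCompletion K] :=
    inferInstanceAs (HenselianLocalRing (v.adicCompletionIntegers K))
  have hint : (Valued.v (R := v.adicCompletion K)).Integers 𝒪[v.adicCompletion K] :=
    Valuation.integer.integers _
  have hvalO : ∀ n : ℤ, Valued.v (((n : 𝒪[v.adicCompletion K]) : v.adicCompletion K)) =
      v.intValuation (n : 𝓞 K) := fun n => by
    rw [← valued_intCast_adicCompletion v n]
    simp
  -- `ℓ ∈ 𝔪_v`, `2 ∈ 𝒪_vˣ`
  have hℓm : (ℓ : 𝒪[v.adicCompletion K]) ∈ IsLocalRing.maximalIdeal 𝒪[v.adicCompletion K] := by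
    rw [IsLocalRing.mem_maximalIdeal, mem_nonunits_iff, hint.isUnit_iff_valuation_eq_one]
    apply ne_of_lt
    change Valued.v ((((ℓ : 𝒪[v.adicCompletion K])) : v.adicCompletion K)) < 1
    rw [← Int.cast_natCast, hvalO, HeightOneSpectrum.intValuation_lt_one_iff_mem, Int.cast_natCast]
    exact hℓv
  have h2v : ((2 : ℤ) : 𝓞 K) ∉ v.asIdeal := by
    intro h
    have h22 : (ℓ : ℤ) ∣ 2 := (intCast_mem_asIdeal_iff_of_natCast_mem hℓ v hℓv 2).1 h
    have : ℓ ∣ 2 := by exact_mod_cast h22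
    exact hℓ2 ((Nat.prime_dvd_prime_iff_eq hℓ Nat.prime_two).1 this)
  have hu2 : IsUnit (2 : 𝒪[v.adicCompletion K]) := by
    rw [hint.isUnit_iff_valuation_eq_one]
    change Valued.v (((((2 : ℤ) : 𝒪[v.adicCompletion K])) : v.adicCompletion K)) = 1
    rw [hvalO]
    exact HeightOneSpectrum.intValuation_eq_one_iff.2 h2v
  -- Hensel at `z₀ = 1`
  obtain ⟨k, hk⟩ := hd
  have hc : (1 : 𝒪[v.adicCompletion K]) ^ 2 - ((d : ℤ) : 𝒪[v.adicCompletion K]) ∈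
      IsLocalRing.maximalIdeal 𝒪[v.adicCompletion K] := by
    have h : (1 : 𝒪[v.adicCompletion K]) ^ 2 - ((d : ℤ) : 𝒪[v.adicCompletion K]) =
        -(((ℓ : ℤ) : 𝒪[v.adicCompletion K]) * ((k : ℤ) : 𝒪[v.adicCompletion K])) := by
      have h' := congrArg (Int.cast : ℤ → 𝒪[v.adicCompletion K]) hk
      push_cast at h' ⊢
      linear_combination (-1 : 𝒪[v.adicCompletion K]) * h'
    rw [h]
    exact neg_mem (Ideal.mul_mem_right _ _ hℓm)
  obtain ⟨z, hz⟩ := exists_sq_eq_of_sq_sub_mem_maximalIdeal hu2 isUnit_one hc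
  refine ⟨(z : v.adicCompletion K), ?_⟩
  have hz' : ((z : v.adicCompletion K)) ^ 2 = (d : v.adicCompletion K) := by
    have h := congrArg (fun t : 𝒪[v.adicCompletion K] => (t : v.adicCompletion K)) hz
    simpa using h
  rw [map_intCast, ← sq, hz']

/-! ### Hensel at a dyadic place: `d ≡ 1 (mod 8)` -/

/-- **`d ≡ 1 (mod 8)` is a square in `K_v` for every `v ∣ 2`**, whatever the ramification of `v` over
`2` (the easy half of the dyadic Local Square Theorem, O'Meara 63:1: `1 + 4𝔭·2 ⊆ K_v²`). Write
`d = 1 + 8k`; the polynomial `X² + X - 2k` has the simple root `0` modulo `𝔪_v` (`2 ∈ 𝔪_v`, derivative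
`2X + 1 ≡ 1`), so Hensel's lemma in the Henselian ring `𝒪_v` gives `y ∈ 𝒪_v` with `y² + y = 2k`, and
then `(2y + 1)² = 4(y² + y) + 1 = d`. [cite: Omeara1963, §63A (63:1)] [cite: Cassels1986, Ch. 4 Lemma 3.1] -/
theorem isSquare_adicCompletion_intCast_of_eight_dvd_sub_one (v : HeightOneSpectrum (𝓞 K))
    (h2v : ((2 : ℕ) : 𝓞 K) ∈ v.asIdeal) {d : ℤ} (hd : (8 : ℤ) ∣ d - 1) :
    IsSquare (algebraMap K (v.adicCompletion K) (d : K)) := by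
  haveI : HenselianLocalRing 𝒪[v.adicCompletion K] :=
    inferInstanceAs (HenselianLocalRing (v.adicCompletionIntegers K))
  have hint : (Valued.v (R := v.adicCompletion K)).Integers 𝒪[v.adicCompletion K] :=
    Valuation.integer.integers _
  have hvalO : ∀ n : ℤ, Valued.v (((n : 𝒪[v.adicCompletion K]) : v.adicCompletion K)) =
      v.intValuation (n : 𝓞 K) := fun n => by
    rw [← valued_intCast_adicCompletion v n]
    simp
  -- `2 ∈ 𝔪_v`
  have h2m : (2 : 𝒪[v.adicCompletion K]) ∈ IsLocalRing.maximalIdeal 𝒪[v.adicCompletion K] := by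
    rw [IsLocalRing.mem_maximalIdeal, mem_nonunits_iff, hint.isUnit_iff_valuation_eq_one]
    apply ne_of_lt
    change Valued.v ((((2 : 𝒪[v.adicCompletion K])) : v.adicCompletion K)) < 1
    have h := hvalO 2
    push_cast at h
    rw [h, HeightOneSpectrum.intValuation_lt_one_iff_mem]
    exact_mod_cast h2v
  -- Hensel for `X² + X - 2k` at `0`
  obtain ⟨k, hk⟩ := hd
  obtain ⟨y, hy, -⟩ := HenselianLocalRing.is_henselian
    (Polynomial.X ^ 2 + (Polynomial.X - Polynomial.C ((2 : 𝒪[v.adicCompletion K]) * (k : 𝒪[v.adicCompletion K]))))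
    ((Polynomial.monic_X_pow 2).add_of_left (by
      rw [Polynomial.degree_X_sub_C, Polynomial.degree_X_pow]
      norm_num))
    0
    (by
      simp only [Polynomial.eval_add, Polynomial.eval_pow, Polynomial.eval_X, Polynomial.eval_sub,
        Polynomial.eval_C, ne_eq, OfNat.ofNat_ne_zero, not_false_eq_true, zero_pow, zero_sub, zero_add]
      exact neg_mem (Ideal.mul_mem_right _ _ h2m))
    (by
      simp only [Polynomial.derivative_add, Polynomial.derivative_X_pow, Polynomial.derivative_sub,
        Polynomial.derivative_X, Polynomial.derivative_C, sub_zero, Polynomial.eval_add, Polynomial.eval_mul,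
        Polynomial.eval_C, Polynomial.eval_pow, Polynomial.eval_X, Polynomial.eval_one]
      norm_num)
  have hy' : y ^ 2 + y = 2 * (k : 𝒪[v.adicCompletion K]) := by
    have h := hy.eq_zero
    simp only [Polynomial.eval_add, Polynomial.eval_pow, Polynomial.eval_X, Polynomial.eval_sub,
      Polynomial.eval_C] at h
    linear_combination h
  -- `(2y + 1)² = 8k + 1 = d`
  have hz : (2 * y + 1) ^ 2 = ((d : ℤ) : 𝒪[v.adicCompletion K]) := by
    have h' := congrArg (Int.cast : ℤ → 𝒪[v.adicCompletion K]) hk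
    push_cast at h'
    linear_combination (4 : 𝒪[v.adicCompletion K]) * hy' - h'
  refine ⟨((2 * y + 1 : 𝒪[v.adicCompletion K]) : v.adicCompletion K), ?_⟩
  have hz' : (((2 * y + 1 : 𝒪[v.adicCompletion K]) : v.adicCompletion K)) ^ 2 = (d : v.adicCompletion K) := by
    have h := congrArg (fun t : 𝒪[v.adicCompletion K] => (t : v.adicCompletion K)) hz
    simpa using h
  rw [map_intCast, ← sq, hz']

end Literature.NumberTheory.NumberFields

end
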